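import Literature.NumberTheory.NumberFields.KurodaRelationSymmetricThree
import HarnessLib

/-!
# The ambiguous term of the `S₃` relation: `τ`-fixed `q`-torsion classes of `L` versus `Cl(L^{⟨τ⟩})[q]`
# (sandwich up to `2`-torsion), and the `⟨σ,τ⟩`-fixed term over a base with no `q`-torsion

Topic `NumberTheory/NumberFields`.  THEOREM-ONLY file (no definition, no named fact, no `sorry`), written by the
prover seat `bsd-line-att-p3` g33 (cell `bsd-f1-sign2`; `--supports` stmt-BirchSwinnertonDyer-22298; closes
nothing).  Sequel of `KurodaRelationSymmetricThree.lean`: there `#Cl(L)[q] · ρ² = #Cl(L^{⟨σ⟩})[q] · a²` with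
`a = #{c ∈ Cl(L)[q] : τc = c}` (ambiguous `q`-torsion classes of the quadratic step `L/L^{⟨τ⟩}`) and
`ρ = #{c ∈ Cl(L)[q] : σc = c, τc = c}`.  For `q = 2^m` the ambiguous count `a` is NOT a class number; this file
bounds it against `k = L^{⟨τ⟩}` using only `N ∘ i = [L : k] ∣ 2` and `i ∘ N = 1 + τ` on `τ`-fixed classes
([NeukirchANT1999] III (1.6) (ii), (iv)):

* `card_torsion_fixedField_le` — `#Cl(k)[q] ≤ #Cl(k)[2] · a` (the capitulation kernel of `i : Cl(k) → Cl(L)` is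
  `2`-torsion, extended classes are `τ`-fixed);
* `card_fixed_torsion_le` — `a ≤ #Cl(L)[2] · #Cl(k)[q]` (on `τ`-fixed classes `c² ∈ i(Cl(k)[q])`, resp. `c ∈ i(…)`
  when `τ = 1`);
* `pow_card_eq_one_of_forall_smul_eq` — a class fixed by a subgroup `H` with `c^q = 1` satisfies `c^{#H} = 1` as
  soon as `Cl(L^H)` has no `q`-torsion (`c^{#H} = i(N c)`); hence (`card_fixed_torsion_le_card_two_torsion_fixed`) for
  `H = ⟨σ, τ⟩` of order not divisible by `4` and `q = 2^m`: `ρ ≤ #{c ∈ Cl(L)[2] : σc = c} = #Cl(L^{⟨σ⟩})[2]`.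

So, in `2`-adic valuations, `e(L^{⟨σ⟩}) + 2e(k) − 2r(k) − 2r(L^{⟨σ⟩}) ≤ e(L) ≤ e(L^{⟨σ⟩}) + 2e(k) + 2r(L)` for an
`S₃`-extension `L/F` with `2 ∤ h(F)` (`e = ord₂ h`, `r = rank₂ Cl`); along a `ℤ₂`-tower with bounded ranks this
pins `λ(L) = λ(L^{⟨σ⟩}) + 2λ(k)` (`IwasawaTheory/SymmetricThreeTowerLambda.lean`).  The EXACT finite-level
relation `e(L) + 2e(F) = e(L^{⟨σ⟩}) + 2e(k)` is [Bartel2012] Thm. 1.2 (analytic; not used).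

References: [NeukirchANT1999] Ch. III §1 Prop. (1.6) (ii), (iv); [Washington1997] §10.1; [Lang1990] Ch. 13 §4
(ambiguous classes); [Lemmermeyer1994] §1; [Bartel2012] Thm. 1.2.
-/

noncomputable section

open scoped Classical NumberField nonZeroDivisors

namespace Literature.NumberTheory.NumberFields.KurodaSymmetricThree

open IsDedekindDomain NumberField Literature.NumberTheory.NumberFields

variable (F L : Type) [Field F] [NumberField F] [Field L] [NumberField L] [Algebra F L] [IsGalois F L]

/-! ### §1 Automorphisms over an intermediate field -/

omit [IsGalois F L] in
/-- An element of `H` is an automorphism of `L` over `L^H` (Galois correspondence).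
[cite: MilneFT2022, Ch. 3 (fundamental theorem of Galois theory)] -/
theorem exists_algEquiv_restrictScalars_eq (H : Subgroup (L ≃ₐ[F] L)) {g : L ≃ₐ[F] L} (hg : g ∈ H) :
    ∃ ρ : L ≃ₐ[IntermediateField.fixedField H] L, ρ.restrictScalars F = g := by
  haveI : FiniteDimensional F L := Module.Finite.of_restrictScalars_finite ℚ F L
  have hg' : g ∈ IntermediateField.fixingSubgroup (IntermediateField.fixedField H) := by
    rw [IntermediateField.fixingSubgroup_fixedField]; exact hg
  exact ⟨{ g with commutes' := fun x => hg' x }, by ext; rfl⟩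

omit [IsGalois F L] in
/-- An automorphism of `L` over `L^H` restricts to an element of `H` (Galois correspondence).
[cite: MilneFT2022, Ch. 3 (fundamental theorem of Galois theory)] -/
theorem restrictScalars_mem (H : Subgroup (L ≃ₐ[F] L)) (ρ : L ≃ₐ[IntermediateField.fixedField H] L) :
    ρ.restrictScalars F ∈ H := by
  haveI : FiniteDimensional F L := Module.Finite.of_restrictScalars_finite ℚ F L
  have h1 : ρ.restrictScalars F ∈ IntermediateField.fixingSubgroup (IntermediateField.fixedField H) :=
    fun x => ρ.commutes x
  rwa [IntermediateField.fixingSubgroup_fixedField H] at h1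

omit [NumberField F] [IsGalois F L] in
/-- A class fixed by `g` is fixed by every element of `⟨g⟩` (ambiguous classes of a cyclic group are those fixed by a
generator). [cite: Lang1990, Ch. 13 §4 (ambiguous classes)] -/
theorem forall_mem_zpowers_smul_eq {g : L ≃ₐ[F] L} {c : ClassGroup (𝓞 L)}
    (h : ClassGroup.mulEquiv (AmbiguousClass.intAut g) c = c) :
    ∀ g' ∈ Subgroup.zpowers g, ClassGroup.mulEquiv (AmbiguousClass.intAut g') c = c := by
  intro g' hg'
  have hg'' : g' ∈ Subgroup.closure ({g} : Set (L ≃ₐ[F] L)) := by rwa [← Subgroup.zpowers_eq_closure]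
  exact forall_mem_closure_smul_eq_of_forall F L (fun x hx => by rw [Set.mem_singleton_iff.mp hx]; exact h) g' hg''

omit [IsGalois F L] in
/-- `[L : L^{⟨τ⟩}] = ord τ ∣ 2` for `τ² = 1`. [cite: MilneFT2022, Ch. 3 (fundamental theorem of Galois theory)] -/
theorem finrank_fixedField_zpowers_dvd_two (τ : L ≃ₐ[F] L) (hτ : τ ^ 2 = 1) :
    Module.finrank (IntermediateField.fixedField (Subgroup.zpowers τ)) L ∣ 2 := by
  haveI : FiniteDimensional F L := Module.Finite.of_restrictScalars_finite ℚ F L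
  rw [IntermediateField.finrank_fixedField_eq_card, Nat.card_zpowers]
  exact orderOf_dvd_of_pow_eq_one hτ

/-! ### §2 The ambiguous `q`-torsion classes of `L/L^{⟨τ⟩}` versus `Cl(L^{⟨τ⟩})[q]` -/

omit [IsGalois F L] in
/-- **`#Cl(k)[q] ≤ #Cl(k)[2] · #{c ∈ Cl(L)[q] : τc = c}`** for `k = L^{⟨τ⟩}`, `τ² = 1`: the extension map
`i : Cl(k)[q] → Cl(L)` lands in the `τ`-fixed `q`-torsion classes and its kernel is `2`-torsion (`N ∘ i = [L:k] ∣ 2`).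
[cite: NeukirchANT1999, Ch. III §1 Prop. (1.6) (ii), (iv)] -/
theorem card_torsion_fixedField_le (τ : L ≃ₐ[F] L) (hτ : τ ^ 2 = 1) (q : ℕ) :
    Nat.card {d : ClassGroup (𝓞 (IntermediateField.fixedField (Subgroup.zpowers τ))) // d ^ q = 1} ≤
      Nat.card {d : ClassGroup (𝓞 (IntermediateField.fixedField (Subgroup.zpowers τ))) // d ^ 2 = 1} *
        Nat.card {c : ClassGroup (𝓞 L) // c ^ q = 1 ∧ ClassGroup.mulEquiv (AmbiguousClass.intAut τ) c = c} := by
  set k := IntermediateField.fixedField (Subgroup.zpowers τ) with hk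
  obtain ⟨τk, hτk⟩ := exists_algEquiv_restrictScalars_eq F L (Subgroup.zpowers τ) (Subgroup.mem_zpowers τ)
  -- the extension map on the `q`-torsion subgroup
  let Aq : Subgroup (ClassGroup (𝓞 k)) := (powMonoidHom q).ker
  let f : Aq →* ClassGroup (𝓞 L) := (classGroupExtend k L).comp Aq.subtype
  have hcard : Nat.card f.ker * Nat.card f.range = Nat.card Aq := by
    rw [← Subgroup.index_ker, Subgroup.card_mul_index]
  have cardAq : Nat.card Aq = Nat.card {d : ClassGroup (𝓞 k) // d ^ q = 1} :=
    Nat.card_congr (Equiv.subtypeEquivRight fun d => by rw [MonoidHom.mem_ker, powMonoidHom_apply])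
  -- kernel ⊆ `2`-torsion
  have hker : Nat.card f.ker ≤ Nat.card {d : ClassGroup (𝓞 k) // d ^ 2 = 1} := by
    refine Nat.card_le_card_of_injective (fun x => ⟨x.1.1, ?_⟩) ?_
    · have hx : classGroupExtend k L x.1.1 = 1 := x.2
      have h1 := pow_finrank_eq_one_of_classGroupExtend_eq_one k L hx
      obtain ⟨c, hc⟩ := finrank_fixedField_zpowers_dvd_two F L τ hτ
      rw [hc, pow_mul, h1, one_pow]
    · intro x y hxy
      have h := congrArg Subtype.val hxy
      dsimp only at h
      exact Subtype.ext (Subtype.ext h)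
  -- range ⊆ `τ`-fixed `q`-torsion
  have hrange : Nat.card f.range ≤
      Nat.card {c : ClassGroup (𝓞 L) // c ^ q = 1 ∧ ClassGroup.mulEquiv (AmbiguousClass.intAut τ) c = c} := by
    refine Nat.card_le_card_of_injective (fun y => ⟨y.1, ?_⟩) ?_
    · obtain ⟨x, hx⟩ := y.2
      have hxq : x.1 ^ q = 1 := x.2
      refine ⟨?_, ?_⟩
      · rw [← hx]
        show (classGroupExtend k L x.1) ^ q = 1
        rw [← map_pow, hxq, map_one]
      · rw [← hx, ← hτk]
        exact KurodaOddPart.galois_smul_classGroupExtend F L k τk x.1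
    · intro x y hxy
      have h := congrArg Subtype.val hxy
      dsimp only at h
      exact Subtype.ext h
  rw [← cardAq, ← hcard]
  exact Nat.mul_le_mul hker hrange

/-- **`#{c ∈ Cl(L)[q] : τc = c} ≤ #Cl(L)[2] · #Cl(k)[q]`** for `k = L^{⟨τ⟩}`, `τ² = 1`: on `τ`-fixed classes
`c^{[L:k]} = i_{L/k}(N_{L/k} c)` ([L:k] ∣ 2), so `c ↦ c²` maps the `τ`-fixed `q`-torsion into `i(Cl(k)[q])` with
`2`-torsion kernel. [cite: NeukirchANT1999, Ch. III §1 Prop. (1.6) (iv)] [cite: Lang1990, Ch. 13 §4] -/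
theorem card_fixed_torsion_le (τ : L ≃ₐ[F] L) (hτ : τ ^ 2 = 1) (q : ℕ) :
    Nat.card {c : ClassGroup (𝓞 L) // c ^ q = 1 ∧ ClassGroup.mulEquiv (AmbiguousClass.intAut τ) c = c} ≤
      Nat.card {c : ClassGroup (𝓞 L) // c ^ 2 = 1} *
        Nat.card {d : ClassGroup (𝓞 (IntermediateField.fixedField (Subgroup.zpowers τ))) // d ^ q = 1} := by
  set k := IntermediateField.fixedField (Subgroup.zpowers τ) with hk
  let fτ : ClassGroup (𝓞 L) →* ClassGroup (𝓞 L) := (ClassGroup.mulEquiv (AmbiguousClass.intAut τ)).toMonoidHom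
  let B : Subgroup (ClassGroup (𝓞 L)) := (powMonoidHom q).ker ⊓ fτ.eqLocus (MonoidHom.id _)
  have memB : ∀ c, c ∈ B ↔ c ^ q = 1 ∧ ClassGroup.mulEquiv (AmbiguousClass.intAut τ) c = c := fun c => by
    rw [Subgroup.mem_inf, MonoidHom.mem_ker, powMonoidHom_apply]
    exact Iff.rfl
  have cardB : Nat.card B =
      Nat.card {c : ClassGroup (𝓞 L) // c ^ q = 1 ∧ ClassGroup.mulEquiv (AmbiguousClass.intAut τ) c = c} :=
    Nat.card_congr (Equiv.subtypeEquivRight memB)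
  -- squaring on `B`
  let g : B →* ClassGroup (𝓞 L) := (powMonoidHom 2).comp B.subtype
  have hcard : Nat.card g.ker * Nat.card g.range = Nat.card B := by
    rw [← Subgroup.index_ker, Subgroup.card_mul_index]
  have hker : Nat.card g.ker ≤ Nat.card {c : ClassGroup (𝓞 L) // c ^ 2 = 1} := by
    refine Nat.card_le_card_of_injective (fun x => ⟨x.1.1, x.2⟩) ?_
    intro x y hxy
    have h := congrArg Subtype.val hxy
    dsimp only at h
    exact Subtype.ext (Subtype.ext h)
  -- a `τ`-fixed class is fixed by `Gal(L/k) = ⟨τ⟩`, hence `c^{[L:k]} = i(N c)`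
  have hfix : ∀ c : ClassGroup (𝓞 L), ClassGroup.mulEquiv (AmbiguousClass.intAut τ) c = c →
      ∀ ρ : L ≃ₐ[k] L, ClassGroup.mulEquiv (AmbiguousClass.intAut ρ) c = c := by
    intro c hc ρ
    have hmem := restrictScalars_mem F L (Subgroup.zpowers τ) ρ
    have key : AmbiguousClass.intAut ρ = AmbiguousClass.intAut (ρ.restrictScalars F) := rfl
    rw [key]
    exact forall_mem_zpowers_smul_eq F L hc (ρ.restrictScalars F) hmem
  have hrange : Nat.card g.range ≤ Nat.card {d : ClassGroup (𝓞 k) // d ^ q = 1} := by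
    -- `range g ⊆ i '' Cl(k)[q]`
    have hsub : (g.range : Set (ClassGroup (𝓞 L))) ⊆
        classGroupExtend k L '' {d : ClassGroup (𝓞 k) | d ^ q = 1} := by
      rintro _ ⟨x, rfl⟩
      obtain ⟨hxq, hxτ⟩ := (memB x.1).mp x.2
      have hN : (classGroupNorm k L x.1) ^ q = 1 := by rw [← map_pow, hxq, map_one]
      have h2 := pow_finrank_eq_classGroupExtend_classGroupNorm_of_forall_smul_eq k L (hfix x.1 hxτ)
      obtain ⟨c, hc⟩ := finrank_fixedField_zpowers_dvd_two F L τ hτ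
      refine ⟨(classGroupNorm k L x.1) ^ c, ?_, ?_⟩
      · show ((classGroupNorm k L x.1) ^ c) ^ q = 1
        rw [← pow_mul, mul_comm, pow_mul, hN, one_pow]
      · show classGroupExtend k L (classGroupNorm k L x.1 ^ c) = x.1 ^ 2
        rw [map_pow, ← h2, ← pow_mul, ← hc]
    have hfin : ({d : ClassGroup (𝓞 k) | d ^ q = 1} : Set _).Finite := Set.toFinite _
    calc Nat.card g.range = Nat.card (g.range : Set (ClassGroup (𝓞 L))) := rfl
      _ ≤ Nat.card (classGroupExtend k L '' {d : ClassGroup (𝓞 k) | d ^ q = 1}) :=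
          Nat.card_mono (hfin.image _) hsub
      _ ≤ Nat.card ({d : ClassGroup (𝓞 k) | d ^ q = 1} : Set _) := Nat.card_image_le hfin
      _ = Nat.card {d : ClassGroup (𝓞 k) // d ^ q = 1} := rfl
  rw [← cardB, ← hcard]
  exact Nat.mul_le_mul hker hrange

/-! ### §3 The `H`-fixed `q`-torsion over a base `L^H` without `q`-torsion -/

/-- **A class with `c^q = 1` fixed by `H` has `c^{#H} = 1` when `Cl(L^H)` has no `q`-torsion**: for such `c`,
`c^{#H} = c^{[L:L^H]} = i(N c)` and `(N c)^q = 1` forces `N c = 1`. [cite: NeukirchANT1999, Ch. III §1 Prop. (1.6) (iv)]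
[cite: Lang1990, Ch. 13 §4] -/
theorem pow_card_eq_one_of_forall_smul_eq (H : Subgroup (L ≃ₐ[F] L)) {q : ℕ} (hq : ∀ d : ClassGroup (𝓞 (IntermediateField.fixedField H)), d ^ q = 1 → d = 1)
    {c : ClassGroup (𝓞 L)} (hcq : c ^ q = 1)
    (hc : ∀ g ∈ H, ClassGroup.mulEquiv (AmbiguousClass.intAut g) c = c) :
    c ^ Nat.card H = 1 := by
  haveI : FiniteDimensional F L := Module.Finite.of_restrictScalars_finite ℚ F L
  set E := IntermediateField.fixedField H with hEdef
  have hfix : ∀ ρ : L ≃ₐ[E] L, ClassGroup.mulEquiv (AmbiguousClass.intAut ρ) c = c := by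
    intro ρ
    have key : AmbiguousClass.intAut ρ = AmbiguousClass.intAut (ρ.restrictScalars F) := rfl
    rw [key]
    exact hc _ (restrictScalars_mem F L H ρ)
  have h2 := pow_finrank_eq_classGroupExtend_classGroupNorm_of_forall_smul_eq E L hfix
  have hN : classGroupNorm E L c = 1 := hq _ (by rw [← map_pow, hcq, map_one])
  rw [← IntermediateField.finrank_fixedField_eq_card, h2, hN, map_one]

/-- **`ρ ≤ #Cl(L^{⟨σ⟩})[2]`.**  For `q = 2^m` (`m ≥ 1`), `H = ⟨σ, τ⟩` with `4 ∤ #H`, `σ³ = 1`, and `Cl(L^H)` without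
`q`-torsion (e.g. `2 ∤ h(L^H)`): every `⟨σ,τ⟩`-fixed class with `c^q = 1` has `c² = 1`, so
`#{c ∈ Cl(L)[q] : σc = c, τc = c} ≤ #{c ∈ Cl(L)[2] : σc = c} = #Cl(L^{⟨σ⟩})[2]`.
[cite: NeukirchANT1999, Ch. III §1 Prop. (1.6) (ii), (iv)] [cite: Washington1997, §10.1] -/
theorem card_fixed_torsion_le_card_two_torsion_fixedField (σ τ : L ≃ₐ[F] L) (hσ : σ ^ 3 = 1)
    (h4 : ¬ 4 ∣ Nat.card (Subgroup.closure ({σ, τ} : Set (L ≃ₐ[F] L)))) {m : ℕ}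
    (hq : ∀ d : ClassGroup (𝓞 (IntermediateField.fixedField (Subgroup.closure ({σ, τ} : Set (L ≃ₐ[F] L))))),
      d ^ 2 ^ m = 1 → d = 1) :
    Nat.card {c : ClassGroup (𝓞 L) // c ^ 2 ^ m = 1 ∧ ClassGroup.mulEquiv (AmbiguousClass.intAut σ) c = c ∧
        ClassGroup.mulEquiv (AmbiguousClass.intAut τ) c = c} ≤
      Nat.card {d : ClassGroup (𝓞 (IntermediateField.fixedField (Subgroup.zpowers σ))) // d ^ 2 = 1} := by
  set H := Subgroup.closure ({σ, τ} : Set (L ≃ₐ[F] L)) with hH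
  -- `c^{#H} = 1` and `c^{2^m} = 1` give `c² = 1` since `gcd(#H, 2^m) ∣ 2`
  have hgcd : Nat.gcd (Nat.card H) (2 ^ m) ∣ 2 := by
    have h1 : Nat.gcd (Nat.card H) (2 ^ m) ∣ 2 ^ m := Nat.gcd_dvd_right _ _
    obtain ⟨j, hj, hjeq⟩ := (Nat.dvd_prime_pow Nat.prime_two).mp h1
    rw [hjeq]
    rcases Nat.lt_or_ge j 2 with hj2 | hj2
    · interval_cases j
      · exact one_dvd 2
      · exact dvd_rfl
    · exfalso
      apply h4
      have h3 : 2 ^ j ∣ Nat.card H := hjeq ▸ Nat.gcd_dvd_left _ _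
      exact (pow_dvd_pow 2 hj2).trans h3
  have htwo : ∀ c : ClassGroup (𝓞 L), c ^ 2 ^ m = 1 →
      ClassGroup.mulEquiv (AmbiguousClass.intAut σ) c = c → ClassGroup.mulEquiv (AmbiguousClass.intAut τ) c = c →
      c ^ 2 = 1 := by
    intro c hcq hcσ hcτ
    have hcH : ∀ g ∈ H, ClassGroup.mulEquiv (AmbiguousClass.intAut g) c = c :=
      forall_mem_closure_smul_eq_of_forall F L (fun g hg => by
        rcases hg with hg | hg
        · rw [hg]; exact hcσ
        · rw [Set.mem_singleton_iff.mp hg]; exact hcτ)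
    have h1 : c ^ Nat.card H = 1 := pow_card_eq_one_of_forall_smul_eq F L H hq hcq hcH
    have h2 : c ^ Nat.gcd (Nat.card H) (2 ^ m) = 1 := pow_gcd_eq_one.mpr ⟨h1, hcq⟩
    obtain ⟨e, he⟩ := hgcd
    rw [he, pow_mul, h2, one_pow]
  -- `σ`-fixed `2`-torsion classes of `L` ↔ `2`-torsion classes of `L^{⟨σ⟩}`
  have eK := KurodaOddPart.card_torsion_fixed_eq_card_torsion_fixedField F L (Subgroup.zpowers σ)
    (coprime_finrank_fixedField_zpowers_of_pow_three F L σ hσ (by norm_num : Nat.Coprime 3 2))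
  have fz : ∀ c : ClassGroup (𝓞 L), (∀ g ∈ Subgroup.zpowers σ, ClassGroup.mulEquiv (AmbiguousClass.intAut g) c = c) ↔
      ClassGroup.mulEquiv (AmbiguousClass.intAut σ) c = c :=
    fun c => ⟨fun h => h σ (Subgroup.mem_zpowers σ), fun h => forall_mem_zpowers_smul_eq F L h⟩
  rw [← eK, Nat.card_congr (Equiv.subtypeEquivRight fun c => and_congr_right fun _ => fz c)]
  refine Nat.card_le_card_of_injective (fun c => ⟨c.1, htwo c.1 c.2.1 c.2.2.1 c.2.2.2, c.2.2.1⟩) ?_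
  intro x y hxy
  have h := congrArg Subtype.val hxy
  dsimp only at h
  exact Subtype.ext h

end Literature.NumberTheory.NumberFields.KurodaSymmetricThree

end
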